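import Mathlib.Analysis.Fourier.FiniteAbelian.PontryaginDuality
import Literature.Computability.Cryptography.KitaevPhaseEstimationCircuit
import HarnessLib

/-!
# Hallgren 2005 / class numbers under GRH — step Q2c (sums): Parseval regrouping and amplitude
# factorisation over the characters of a finite abelian group

Topic `Literature/Computability/Cryptography`; proof companion of `HallgrenClassGroup.lean`
(named fact `Hallgren2005_classNumber_qsolvable_of_GRH`). Everything here is PROVED (theorems
only; no definition, no named fact).

Kitaev's eigenvalue measurement for the class group is the Abelian stabilizer problem with `k`
generators acting on the (regular) orbit of the identity: the work register holds a group element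
`P_t(c) ∈ G` per trial `t`, a sum `∑_{τ j = t} c_j · W_j` of fixed group elements `W_j` (powers
`g_i^{2^l}` of the generators) switched on by the control bits `c_j`. The tree's analysis of
Shor's order finding (`KitaevPhaseEstimationSums.lean`: `Kitaev1995.parseval_fibers`,
`Kitaev1995.sum_prod_mul_exp_eq_prod`, for the cyclic case — exponents modulo `r`, characters
`s ↦ e^{2πi s/r}` of `ℤ/r`) is generalised here to an arbitrary finite abelian group `G` (written
additively) and its complex characters `AddChar G ℂ` (Mathlib's Pontryagin duality for finite
abelian groups: `AddChar.card_eq`, `AddChar.sum_apply_eq_ite`):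

* `sum_pi_addChar_prod_apply` — orthogonality of the characters of `G^T`:
  `∑_{ψ : T → Ĝ} ∏_t ψ_t(d_t) = |G|^{#T}` if all `d_t = 0`, else `0`;
* `parseval_fibers_addChar` — **Parseval regrouping**: if `κ` identifies exactly the control
  strings with the same group elements `P_t`, then
  `∑_ω |∑_{κ c = ω} φ(c)|² = |G|^{-#T} ∑_{ψ : T → Ĝ} |∑_c φ(c) ∏_t ψ_t(P_t c)|²`
  (Kitaev 1995, §4: `P(h) = q⁻¹ ∑_{h'} P(h', h)` — a uniformly random character of the stabilised
  group, then the conditional law);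
* `sum_prod_mul_addChar_eq_prod` — **factorisation over independent control bits**: with
  `P_t(c) = ∑_{τ j = t} [c_j] W_j`,
  `∑_c (∏_j χ_j(c_j)) ∏_t ψ_t(P_t c) = ∏_j (χ_j(0) + χ_j(1) ψ_{τ j}(W_j))` (Kitaev 1995, §3,
  Lemma 8(3)).

* `kitaevCircuit_distributionChar` — **the character form of `Kitaev1995.kitaevCircuit_distribution`**:
  if the classical block of Kitaev's circuit writes a work-register content `R y` with `R y = R y'`
  iff the trial elements `P_t` agree, the control read-out `γ` has Born probability
  `|G|^{-#T} ∑_{ψ : T → Ĝ} ∏_j testWeight γ_j σ_j (arg ψ_{τ j}(W_j))` — a uniformly random character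
  per trial, then independent Hadamard tests with eigenvalues `ψ_{τ j}(W_j)` (Kitaev 1995, §3
  Remark 8, Lemma 8; §4). For the class group `G = Cl(−d)` (additively), `W_j = 2^{l_j} · [g_{i_j}]`.

## References

* A. Yu. Kitaev, *Quantum measurements and the Abelian Stabilizer Problem*,
  arXiv:quant-ph/9511026 (1995), §3 Lemma 8, §4 (p. 15) [Kitaev1995].
* K. K. H. Cheung, M. Mosca, *Decomposing finite abelian groups*, QIC 1 (2001) [CheungMosca2001].
* A. M. Childs, W. van Dam, Rev. Mod. Phys. 82 (2010), §5.7 [ChildsVandam2010].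
-/

noncomputable section

namespace Literature.Computability.Cryptography.Hallgren2005

open Complex Finset Kitaev1995

variable {G : Type*} [AddCommGroup G] [Fintype G]

/-! ### Orthogonality of the characters of `G^T` -/

/-- **Orthogonality of the characters of `G^T`**: `∑_{ψ : T → Ĝ} ∏_t ψ_t(d_t)` is `|G|^{#T}` if
`d_t = 0` for all `t` and `0` otherwise (`AddChar.sum_apply_eq_ite` coordinatewise). [folklore] -/
theorem sum_pi_addChar_prod_apply [DecidableEq G] {T : Type*} [Fintype T] [DecidableEq T] (d : T → G) :
    ∑ ψ : T → AddChar G ℂ, ∏ t, ψ t (d t) =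
      if ∀ t, d t = 0 then ((Fintype.card G : ℂ)) ^ Fintype.card T else 0 := by
  classical
  have hswap : ∑ ψ : T → AddChar G ℂ, ∏ t, ψ t (d t) =
      ∏ t : T, ∑ u : AddChar G ℂ, u (d t) := by
    rw [Finset.prod_univ_sum, Fintype.piFinset_univ]
  rw [hswap, prod_congr rfl fun t _ => AddChar.sum_apply_eq_ite (d t)]
  by_cases hall : ∀ t, d t = 0
  · rw [if_pos hall, prod_congr rfl fun t _ => if_pos (hall t), prod_const, card_univ]
  · rw [if_neg hall]
    obtain ⟨t, ht⟩ := not_forall.mp hall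
    exact prod_eq_zero (mem_univ t) (if_neg ht)

/-- Complex conjugation inverts a character of a finite group: `conj (ψ a) = ψ (−a)`. [folklore] -/
theorem conj_addChar_apply (ψ : AddChar G ℂ) (a : G) : (starRingEnd ℂ) (ψ a) = ψ (-a) := by
  rw [AddChar.map_neg_eq_inv, ← Complex.inv_eq_conj (ψ.norm_apply a)]

/-- `ψ(a) · conj ψ(b) = ψ(a − b)`. [folklore] -/
theorem addChar_mul_conj (ψ : AddChar G ℂ) (a b : G) :
    ψ a * (starRingEnd ℂ) (ψ b) = ψ (a - b) := by
  rw [conj_addChar_apply, ← AddChar.map_add_eq_mul, sub_eq_add_neg]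

/-! ### Parseval regrouping -/

/-- **Parseval regrouping over the characters of a finite abelian group.** If the map `κ`
identifies exactly those control strings `c, c'` with `P_t c = P_t c'` for every trial `t`, then
`∑_ω |∑_{κ c = ω} φ(c)|² = |G|^{-#T} ∑_{ψ : T → Ĝ} |∑_c φ(c) ∏_t ψ_t(P_t c)|²`
(the character form of `Kitaev1995.parseval_fibers`; Kitaev 1995, §4: expanding the initial state
in the Fourier basis of the stabilised group, the outcome law is the average over a uniformly random
character of the conditional laws). [cite: Kitaev1995, §4 (P(h) = q^{-1} sum_{h'} P(h',h))] -/
theorem parseval_fibers_addChar {C Ω T : Type*} [Fintype C] [Fintype Ω] [DecidableEq Ω]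
    [Fintype T] [DecidableEq T] (P : T → C → G) (κ : C → Ω)
    (hκ : ∀ c c', κ c = κ c' ↔ ∀ t, P t c = P t c') (φ : C → ℂ) :
    ∑ ω, ‖∑ c ∈ univ.filter (fun c => κ c = ω), φ c‖ ^ 2 =
      (1 / (Fintype.card G : ℝ) ^ Fintype.card T) * ∑ ψ : T → AddChar G ℂ,
        ‖∑ c, φ c * ∏ t, ψ t (P t c)‖ ^ 2 := by
  classical
  have hG0 : (Fintype.card G : ℂ) ≠ 0 := by exact_mod_cast Fintype.card_ne_zero
  apply Complex.ofReal_injective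
  rw [Complex.ofReal_sum, Complex.ofReal_mul, Complex.ofReal_sum]
  -- left-hand side: `∑_c ∑_{c'} [κ c' = κ c] φ c conj(φ c')`
  have hL : (∑ ω, ((‖∑ c ∈ univ.filter (fun c => κ c = ω), φ c‖ ^ 2 : ℝ) : ℂ)) =
      ∑ c, ∑ c', if κ c' = κ c then φ c * (starRingEnd ℂ) (φ c') else 0 := by
    simp_rw [ofReal_norm_sq_sum]
    rw [show (∑ ω, ∑ c ∈ univ.filter (fun c => κ c = ω), ∑ c' ∈ univ.filter (fun c => κ c = ω),
          φ c * (starRingEnd ℂ) (φ c')) =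
        ∑ ω, ∑ c ∈ univ.filter (fun c => κ c = ω), ∑ c' ∈ univ.filter (fun c' => κ c' = κ c),
          φ c * (starRingEnd ℂ) (φ c') from
      sum_congr rfl fun ω _ => sum_congr rfl fun c hc => by rw [(mem_filter.1 hc).2]]
    rw [sum_fiberwise univ κ fun c => ∑ c' ∈ univ.filter (fun c' => κ c' = κ c),
      φ c * (starRingEnd ℂ) (φ c')]
    refine sum_congr rfl fun c _ => ?_
    rw [sum_filter]
  -- right-hand side
  have hR : (((1 / (Fintype.card G : ℝ) ^ Fintype.card T : ℝ) : ℂ) * ∑ ψ : T → AddChar G ℂ,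
      ((‖∑ c, φ c * ∏ t, ψ t (P t c)‖ ^ 2 : ℝ) : ℂ)) =
      ∑ c, ∑ c', if κ c' = κ c then φ c * (starRingEnd ℂ) (φ c') else 0 := by
    simp_rw [ofReal_norm_sq_sum]
    rw [sum_comm, mul_sum]
    refine sum_congr rfl fun c _ => ?_
    rw [sum_comm, mul_sum]
    refine sum_congr rfl fun c' _ => ?_
    -- the characters combine into one character evaluated at the differences
    have hph : ∀ ψ : T → AddChar G ℂ,
        φ c * (∏ t, ψ t (P t c)) * (starRingEnd ℂ) (φ c' * ∏ t, ψ t (P t c')) =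
          φ c * (starRingEnd ℂ) (φ c') * ∏ t, ψ t (P t c - P t c') := by
      intro ψ
      rw [map_mul, map_prod, mul_mul_mul_comm, ← prod_mul_distrib]
      congr 1
      exact prod_congr rfl fun t _ => addChar_mul_conj (ψ t) _ _
    rw [sum_congr rfl fun ψ _ => hph ψ, ← mul_sum, sum_pi_addChar_prod_apply]
    split_ifs with h1 h2 h2
    · push_cast
      field_simp
    · exact absurd ((hκ c c').2 fun t => sub_eq_zero.mp (h1 t)) (Ne.symm h2)
    · exact absurd (fun t => sub_eq_zero.mpr (((hκ c' c).1 h2 t).symm)) h1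
    · simp
  exact hL.trans hR.symm

/-! ### Factorisation over independent control bits -/

omit [Fintype G] in
/-- A character turns finite sums into products. [folklore] -/
theorem addChar_map_finset_sum {ι : Type*} (ψ : AddChar G ℂ) (s : Finset ι) (a : ι → G) :
    ψ (∑ i ∈ s, a i) = ∏ i ∈ s, ψ (a i) := by
  classical
  induction s using Finset.induction_on with
  | empty => simp [AddChar.map_zero_eq_one]
  | insert i s hi ih => rw [sum_insert hi, prod_insert hi, AddChar.map_add_eq_mul, ih]

omit [Fintype G] in
/-- The group element carried by the control bits of trial `t`: `P_t(c) = ∑_{j : τ j = t} [c_j] W_j`,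
summed against characters: `∏_t ψ_t(P_t c) = ∏_j ψ_{τ j}([c_j] W_j)`. [cite: Kitaev1995, §3 (Lemma 10)] -/
theorem prod_addChar_trialSum_eq {J T : Type*} [Fintype J] [Fintype T] [DecidableEq T]
    (τ : J → T) (W : J → G) (ψ : T → AddChar G ℂ) (c : J → Bool) :
    ∏ t, ψ t (∑ j ∈ univ.filter (fun j => τ j = t), if c j then W j else 0) =
      ∏ j, ψ (τ j) (if c j then W j else 0) := by
  classical
  have h1 : ∀ t, ψ t (∑ j ∈ univ.filter (fun j => τ j = t), if c j then W j else 0) =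
      ∏ j ∈ univ.filter (fun j => τ j = t), ψ (τ j) (if c j then W j else 0) := by
    intro t
    rw [addChar_map_finset_sum]
    exact prod_congr rfl fun j hj => by rw [(mem_filter.1 hj).2]
  rw [prod_congr rfl fun t _ => h1 t]
  exact prod_fiberwise univ τ fun j => ψ (τ j) (if c j then W j else 0)

omit [Fintype G] in
/-- **Factorisation of the Kitaev amplitude, character form.** With one-bit factors `χ_j` and the
character value `∏_t ψ_t(P_t c)`, `P_t(c) = ∑_{τ j = t} [c_j] W_j`, the sum over all control strings
factorises: `∑_c (∏_j χ_j(c_j)) ∏_t ψ_t(P_t c) = ∏_j (χ_j(0) + χ_j(1) ψ_{τ j}(W_j))` (the character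
form of `Kitaev1995.sum_prod_mul_exp_eq_prod`; Kitaev 1995, §3, Lemma 8(3): measurements with
disjoint additional registers multiply). [cite: Kitaev1995, §3 Lemma 8] -/
theorem sum_prod_mul_addChar_eq_prod {J T : Type*} [Fintype J] [DecidableEq J] [Fintype T]
    [DecidableEq T] (τ : J → T) (W : J → G) (χ : J → Bool → ℂ) (ψ : T → AddChar G ℂ) :
    ∑ c : J → Bool, (∏ j, χ j (c j)) *
        ∏ t, ψ t (∑ j ∈ univ.filter (fun j => τ j = t), if c j then W j else 0) =
      ∏ j, (χ j false + χ j true * ψ (τ j) (W j)) := by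
  have hterm : ∀ c : J → Bool, (∏ j, χ j (c j)) *
      ∏ t, ψ t (∑ j ∈ univ.filter (fun j => τ j = t), if c j then W j else 0) =
      ∏ j, χ j (c j) * ψ (τ j) (if c j then W j else 0) := by
    intro c
    rw [prod_addChar_trialSum_eq, ← prod_mul_distrib]
  rw [sum_congr rfl fun c _ => hterm c, sum_pi_bool_prod fun j b =>
    χ j b * ψ (τ j) (if b then W j else 0)]
  refine prod_congr rfl fun j _ => ?_
  simp only [Bool.false_eq_true, if_false, if_true, AddChar.map_zero_eq_one, mul_one]

/-! ### The outcome distribution of Kitaev's circuit, character form -/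

section distribution

open _root_.Computability QuantumComplexity Matrix

variable {n k m : ℕ}

/-- **Kitaev's outcome distribution over a finite abelian group** (the character form of
`Kitaev1995.kitaevCircuit_distribution`; Kitaev 1995, §3 Remark 8 and Lemma 8, §4). If the classical
block of Kitaev's circuit writes a work-register content `R y` that separates exactly the trial
elements `P_t(y) = ∑_{τ j = t} [y_j] W_j ∈ G` (`R y = R y'` iff `P_t y = P_t y'` for all trials `t`,
as for `R y =` the tuple of reduced forms `x_t · ∏ g_i^{A_{t,i}(y)}` in the class group), then the
control read-out `γ` has Born probability
`P(γ) = |G|^{-#T} ∑_{ψ : T → Ĝ} ∏_j testWeight γ_j σ_j (arg ψ_{τ j}(W_j))`: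
a uniformly random character `ψ_t` per trial, then independent Hadamard tests whose eigenvalue on
control `j` is `ψ_{τ j}(W_j)`. [cite: Kitaev1995, §3 (Remark 8, Lemma 8) and §4 (composite probability for |a>)] -/
theorem kitaevCircuit_distributionChar [DecidableEq G] (V : QCircuit cliffordT (n + (k + m)))
    (σ : Fin k → Bool) (x : QReg n) (R : QReg k → QReg m)
    (hV : ∀ y : QReg k, V.toMatrix 0 *ᵥ basisState (coinInput x y) = basisState (tri x y (R y)))
    {T : Type*} [Fintype T] [DecidableEq T] (τ : Fin k → T) (W : Fin k → G)
    (hR : ∀ y y' : QReg k, R y = R y' ↔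
      ∀ t, (∑ j ∈ univ.filter (fun j => τ j = t), (if y j then W j else 0)) =
        ∑ j ∈ univ.filter (fun j => τ j = t), (if y' j then W j else 0))
    (γ : QReg k) :
    ∑ ρ : QReg m, ‖(kitaevCircuit V σ).runOn 0 (basisState (padInput x (k + m))) (tri x γ ρ)‖ ^ 2
      = (1 / (Fintype.card G : ℝ) ^ Fintype.card T) *
          ∑ ψ : T → AddChar G ℂ, ∏ j, testWeight (γ j) (σ j) (Complex.arg (ψ (τ j) (W j))) := by
  classical
  -- the amplitudes as fibrewise sums of `φ`
  set χ : Fin k → Bool → ℂ := fun j b =>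
    if b then (if γ j then (-1 : ℂ) else 1) * (if σ j then -I else 1) else 1 with hχ
  set φ : QReg k → ℂ := fun y => (1 / 2 : ℂ) ^ k * ∏ j, χ j (y j) with hφ
  have hamp : ∀ ρ : QReg m,
      (kitaevCircuit V σ).runOn 0 (basisState (padInput x (k + m))) (tri x γ ρ) =
        ∑ y ∈ univ.filter (fun y => R y = ρ), φ y := by
    intro ρ
    rw [kitaevCircuit_runOn_tri V σ x R hV, invSqrt2_pow_mul_pow, mul_sum]
    refine sum_congr rfl fun y _ => ?_
    rw [hφ, sPhase_mul_ySign]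
  simp_rw [hamp]
  -- Parseval over the characters of `G^T`
  rw [parseval_fibers_addChar
    (fun t y => ∑ j ∈ univ.filter (fun j => τ j = t), (if y j then W j else 0)) R hR φ]
  refine congrArg (fun u : ℝ => (1 / (Fintype.card G : ℝ) ^ Fintype.card T) * u) ?_
  refine Finset.sum_congr rfl fun ψ _ => ?_
  -- factorisation of the character sum
  have hfac : ∑ y : QReg k, φ y *
      ∏ t, ψ t (∑ j ∈ univ.filter (fun j => τ j = t), (if y j then W j else 0)) =
      ∏ j, (1 + χ j true * ψ (τ j) (W j)) / 2 := by
    have h1 : ∀ y : QReg k, φ y *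
        ∏ t, ψ t (∑ j ∈ univ.filter (fun j => τ j = t), (if y j then W j else 0)) =
        (1 / 2 : ℂ) ^ k * ((∏ j, χ j (y j)) *
          ∏ t, ψ t (∑ j ∈ univ.filter (fun j => τ j = t), (if y j then W j else 0))) := by
      intro y
      rw [hφ, mul_assoc]
    rw [sum_congr rfl fun y _ => h1 y, ← mul_sum, sum_prod_mul_addChar_eq_prod τ W χ ψ,
      prod_div_distrib, prod_const, card_univ, Fintype.card_fin]
    have hχ0 : ∀ j, χ j false = 1 := fun j => by simp [hχ]
    simp_rw [hχ0]
    rw [one_div, inv_pow, ← div_eq_inv_mul]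
  rw [hfac, norm_prod, ← prod_pow]
  refine prod_congr rfl fun j _ => ?_
  -- the single-test probability, with `ψ_{τ j}(W_j) = e^{i arg}`
  have hunit : ψ (τ j) (W j) = cexp ((Complex.arg (ψ (τ j) (W j)) : ℂ) * I) := by
    have h := Complex.norm_mul_exp_arg_mul_I (ψ (τ j) (W j))
    rw [(ψ (τ j)).norm_apply, Complex.ofReal_one, one_mul] at h
    exact h.symm
  have := norm_sq_testAmplitude (γ j) (σ j) (Complex.arg (ψ (τ j) (W j)))
  rw [testWeight, ← this, hχ]
  simp only [if_true]
  rw [← hunit]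

end distribution

end Literature.Computability.Cryptography.Hallgren2005

end
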